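import Summits.CriticalPhenomena.PercolationContinuityZ3.Theorems.PercNearOneGluingNoHeavyLowerTailCILThreePorts
import HarnessLib

/-!
# `NoHeavyLowerTail` (stmt-CriticalPhenomena-4575) — CIL for every observer whose region has AT MOST THREE ports

Hull-port prover #4 (`prim-hp-4`, LP-duality technique), generation 2; `--supports stmt-CriticalPhenomena-4575`.  No definitions, no
sorries, no named facts.  A REGION of the observer `o` is a finite vertex set `R ∋ o` avoiding the relays `A` and CLOSED under
positive-weight steps to non-relays (e.g. `o` together with the non-relay vertices reachable from `o` through positive-weight pairs); its
PORTS are the relays joined to `R` by a positive-weight pair.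
* `cil_of_threePortRegion`: exactly three ports ⇒ `∃ a ∈ A, μ(1 ≤ N ≤ j) ≤ μ(M_a ≤ j)` (`HullThree.Hull3.cil_threePort`, unbundled).
* `reach_port_of_reach` (first exit): on the support event every open path from `o` to a vertex outside `R` passes through a port;
  `attached_le_of_twoGates_supp`: the two-gate bound of `…CILTwoGates` with the gate hypothesis required only on the support event.
* `cil_of_portRegion_card_le_three` (**CIL for every observer with at most three hull ports**): if `R` has at most three ports (and `A`
  is nonempty), then `∃ a ∈ A, μ(1 ≤ N ≤ j) ≤ μ(M_a ≤ j)` — the registered stub `stub_cumulativeIsolation` of the crux on this class,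
  for every level and every finite weighted graph.
-/

noncomputable section

namespace Summit.CriticalPhenomena.PercolationContinuityZ3.Theorems

open MeasureTheory Set Literature.Probability.LatticeModels Literature.Probability.Percolation
open scoped Classical BigOperators

variable {n : ℕ}

open HullThree in
/-- **CIL for a three-port region.**  If `o ∈ R`, `R` avoids the relays, `R` is closed under positive-weight steps to non-relays, and
exactly three relays are adjacent to `R` with positive weight, then `∃ a ∈ A, μ(1 ≤ N ≤ j) ≤ μ(M_a ≤ j)`.
[derived from: VandenbergHaggstromKahn2005, Thm. 1.5 — via `HullThree.Hull3.cil_threePort`] -/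
theorem cil_of_threePortRegion (w : Sym2 (Fin n) → unitInterval) (A R : Finset (Fin n)) (o : Fin n) (j : ℕ)
    (ho : o ∈ R) (hRA : ∀ a ∈ A, a ∉ R) (hclosed : ∀ u ∈ R, ∀ v, v ∉ A → w s(u, v) ≠ 0 → v ∈ R)
    (hports : (A.filter fun a => ∃ u ∈ R, w s(u, a) ≠ 0).card = 3) :
    ∃ a ∈ A,
      (prodBernoulli w).real {ω : BondConfig (Fin n) |
          1 ≤ (A.filter fun x => ω ∈ openConn o x).card ∧ (A.filter fun x => ω ∈ openConn o x).card ≤ j} ≤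
        (prodBernoulli w).real {ω : BondConfig (Fin n) | (A.filter fun x => ω ∈ openConn a x).card ≤ j} := by
  set P := A.filter fun a => ∃ u ∈ R, w s(u, a) ≠ 0 with hP
  let e : P ≃ Fin 3 := Finset.equivFinOfCardEq hports
  let p : Fin 3 → Fin n := fun i => (e.symm i).1
  have hpP : ∀ i, p i ∈ P := fun i => (e.symm i).2
  have hpA : ∀ i, p i ∈ A := fun i => (Finset.mem_filter.1 (hpP i)).1
  let X : Hull3 n :=
    { w := w, R := R, o := o, p := p, ho := ho
      hp := fun i => hRA _ (hpA i)
      hpinj := fun i k hik => e.symm.injective (Subtype.ext hik)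
      hregion := fun u hu v hv hne => by
        by_contra hw
        by_cases hvA : v ∈ A
        · have hvP : v ∈ P := Finset.mem_filter.2 ⟨hvA, u, hu, hw⟩
          have : v = p (e ⟨v, hvP⟩) := by simp [p]
          exact hne _ this
        · exact hv (hclosed u hu v hvA hw) }
  exact Hull3.cil_threePort X A j hRA hpA

/-! ### First exit through a port; the two-gate bound with an almost-sure gate hypothesis -/

/-- **First exit.**  On the support event, if `o ∈ R` reaches a vertex, then that vertex lies in `R` or `o` reaches a port of `R`. -/
theorem reach_port_of_reach (w : Sym2 (Fin n) → unitInterval) (A R : Finset (Fin n)) (o : Fin n) (ho : o ∈ R)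
    (hclosed : ∀ u ∈ R, ∀ v, v ∉ A → w s(u, v) ≠ 0 → v ∈ R) {ω : BondConfig (Fin n)} (hω : ∀ e ∈ ω, w e ≠ 0)
    {a : Fin n} (h : (openGraph ω).Reachable o a) :
    a ∈ R ∨ ∃ q ∈ A.filter (fun a => ∃ u ∈ R, w s(u, a) ≠ 0), (openGraph ω).Reachable o q := by
  rw [SimpleGraph.reachable_iff_reflTransGen] at h
  induction h with
  | refl => exact Or.inl ho
  | @tail b c hob hbc ih =>
    rcases ih with hbR | hq
    · obtain ⟨hmem, _⟩ := (openGraph_adj ω b c).1 hbc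
      have hw : w s(b, c) ≠ 0 := hω _ hmem
      by_cases hcA : c ∈ A
      · refine Or.inr ⟨c, Finset.mem_filter.2 ⟨hcA, b, hbR, hw⟩, ?_⟩
        rw [SimpleGraph.reachable_iff_reflTransGen]
        exact hob.tail hbc
      · exact Or.inl (hclosed b hbR c hcA hw)
    · exact Or.inr hq

open AttachedShift AttachedChampionObserverExchange in
/-- **Two gates on the support event.**  As `attached_le_of_twoGates`, but the gate hypothesis `{o ↔ a} ⊆ {o ↔ b} ∪ {o ↔ b'}` is
required only for configurations all of whose open pairs have positive weight. -/
theorem attached_le_of_twoGates_supp (w : Sym2 (Fin n) → unitInterval) (A : Finset (Fin n)) (o b b' : Fin n) (j : ℕ)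
    (hgate : ∀ ω : BondConfig (Fin n), (∀ e ∈ ω, w e ≠ 0) → ∀ a ∈ A,
      ω ∈ (openConn o a : Set (BondConfig (Fin n))) → ω ∈ (openConn o b : Set (BondConfig (Fin n))) ∪ openConn o b')
    (hle : (prodBernoulli w).real {ω : BondConfig (Fin n) | (A.filter fun x => ω ∈ openConn b' x).card ≤ j} ≤
      (prodBernoulli w).real {ω : BondConfig (Fin n) | (A.filter fun x => ω ∈ openConn b x).card ≤ j}) :
    (prodBernoulli w).real {ω : BondConfig (Fin n) |
        1 ≤ (A.filter fun x => ω ∈ openConn o x).card ∧ (A.filter fun x => ω ∈ openConn o x).card ≤ j} ≤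
      (prodBernoulli w).real {ω : BondConfig (Fin n) | (A.filter fun x => ω ∈ openConn b x).card ≤ j} := by
  set μ := prodBernoulli w with hμ
  set E : Set (BondConfig (Fin n)) := openConn o b
  set F : Set (BondConfig (Fin n)) := openConn o b'
  set Rb : Set (BondConfig (Fin n)) := {ω | (A.filter fun x => ω ∈ openConn b x).card ≤ j}
  set Ro : Set (BondConfig (Fin n)) := {ω | (A.filter fun x => ω ∈ openConn o x).card ≤ j}
  set L : Set (BondConfig (Fin n)) :=
    {ω | 1 ≤ (A.filter fun x => ω ∈ openConn o x).card ∧ (A.filter fun x => ω ∈ openConn o x).card ≤ j}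
  have hmeas : ∀ s : Set (BondConfig (Fin n)), MeasurableSet s := fun _ => MeasurableSet.of_discrete
  -- on the support event, `L ⊆ (E ∩ Rb) ∪ (F ∩ Eᶜ ∩ Ro)`
  have hsub : L ∩ {ω | ∀ e ∈ ω, w e ≠ 0} ⊆ (E ∩ Rb) ∪ (F ∩ Eᶜ ∩ Ro) := by
    rintro ω ⟨⟨h1, hN⟩, hω⟩
    rw [Nat.one_le_iff_ne_zero, Ne, Finset.card_eq_zero, ← Ne, ← Finset.nonempty_iff_ne_empty,
      Finset.filter_nonempty_iff] at h1
    obtain ⟨a, ha, hoa⟩ := h1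
    by_cases hωE : ω ∈ E
    · refine Or.inl ⟨hωE, ?_⟩
      show (A.filter fun x => ω ∈ openConn b x).card ≤ j
      rwa [← card_eq_on_attached A hωE]
    · rcases hgate ω hω a ha hoa with h | h
      · exact absurd h hωE
      · exact Or.inr ⟨⟨h, hωE⟩, hN⟩
  have hdisj : Disjoint (E ∩ Rb) (F ∩ Eᶜ ∩ Rb) := by
    rw [Set.disjoint_left]
    rintro ω ⟨hωE, -⟩ ⟨⟨-, hωE'⟩, -⟩
    exact hωE' hωE
  have hT : (E ∩ Rb) ∪ (F ∩ Eᶜ ∩ Rb) ⊆ Rb := by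
    rintro ω (⟨-, h⟩ | ⟨-, h⟩) <;> exact h
  have hshift := attached_avoid_shift w A o b' b j hle
  calc μ.real L = μ.real (L ∩ {ω | ∀ e ∈ ω, w e ≠ 0}) := (CutObserver.measureReal_inter_support w L).symm
    _ ≤ μ.real ((E ∩ Rb) ∪ (F ∩ Eᶜ ∩ Ro)) := measureReal_mono hsub (measure_ne_top _ _)
    _ ≤ μ.real (E ∩ Rb) + μ.real (F ∩ Eᶜ ∩ Ro) := measureReal_union_le _ _
    _ ≤ μ.real (E ∩ Rb) + μ.real (F ∩ Eᶜ ∩ Rb) := by linarith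
    _ = μ.real ((E ∩ Rb) ∪ (F ∩ Eᶜ ∩ Rb)) := (measureReal_union hdisj (hmeas _)).symm
    _ ≤ μ.real Rb := measureReal_mono hT (measure_ne_top _ _)

/-! ### At most three ports -/

/-- **CIL for every observer with at most three hull ports.**  Let `R ∋ o` avoid the relays and be closed under positive-weight steps
to non-relays, with at most three ports, and let `A` be nonempty.  Then `∃ a ∈ A, μ(1 ≤ N ≤ j) ≤ μ(M_a ≤ j)`. -/
theorem cil_of_portRegion_card_le_three (w : Sym2 (Fin n) → unitInterval) (A R : Finset (Fin n)) (o : Fin n) (j : ℕ)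
    (hAne : A.Nonempty) (ho : o ∈ R) (hRA : ∀ a ∈ A, a ∉ R)
    (hclosed : ∀ u ∈ R, ∀ v, v ∉ A → w s(u, v) ≠ 0 → v ∈ R)
    (hports : (A.filter fun a => ∃ u ∈ R, w s(u, a) ≠ 0).card ≤ 3) :
    ∃ a ∈ A,
      (prodBernoulli w).real {ω : BondConfig (Fin n) |
          1 ≤ (A.filter fun x => ω ∈ openConn o x).card ∧ (A.filter fun x => ω ∈ openConn o x).card ≤ j} ≤
        (prodBernoulli w).real {ω : BondConfig (Fin n) | (A.filter fun x => ω ∈ openConn a x).card ≤ j} := by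
  set P := A.filter fun a => ∃ u ∈ R, w s(u, a) ≠ 0 with hP
  have hPA : ∀ q ∈ P, q ∈ A := fun q hq => (Finset.mem_filter.1 hq).1
  -- the gate property on the support event, for any two relays covering the ports
  have hgate : ∀ b b' : Fin n, (∀ q ∈ P, q = b ∨ q = b') → ∀ ω : BondConfig (Fin n), (∀ e ∈ ω, w e ≠ 0) → ∀ a ∈ A,
      ω ∈ (openConn o a : Set (BondConfig (Fin n))) → ω ∈ (openConn o b : Set (BondConfig (Fin n))) ∪ openConn o b' := by
    intro b b' hcover ω hω a ha hoa
    rcases reach_port_of_reach w A R o ho hclosed hω hoa with haR | ⟨q, hq, hoq⟩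
    · exact absurd haR (hRA a ha)
    · rcases hcover q hq with rfl | rfl
      · exact Or.inl hoq
      · exact Or.inr hoq
  rcases Nat.lt_or_ge P.card 3 with hlt | hge
  · -- at most two ports
    by_cases hP0 : P = ∅
    · -- no port: the observer is almost surely unattached
      obtain ⟨a, ha⟩ := hAne
      refine ⟨a, ha, ?_⟩
      have h := attached_le_of_twoGates_supp w A o a a j
        (hgate a a fun q hq => absurd (hP0 ▸ hq : q ∈ (∅ : Finset (Fin n))) (Finset.notMem_empty q)) le_rfl
      exact h
    · obtain ⟨q, hq⟩ := Finset.nonempty_iff_ne_empty.2 hP0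
      -- a second port (possibly equal to `q`) covering the rest
      have hrest : ∃ q' ∈ P, ∀ r ∈ P, r = q ∨ r = q' := by
        by_cases h1 : ∀ r ∈ P, r = q
        · exact ⟨q, hq, fun r hr => Or.inl (h1 r hr)⟩
        · simp only [not_forall] at h1
          obtain ⟨q', hq', hne⟩ := h1
          refine ⟨q', hq', fun r hr => ?_⟩
          by_contra hcon
          simp only [not_or] at hcon
          have h3 : ({q, q', r} : Finset (Fin n)) ⊆ P := by
            intro x hx
            simp only [Finset.mem_insert, Finset.mem_singleton] at hx
            rcases hx with rfl | rfl | rfl <;> assumption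
          have hcard : ({q, q', r} : Finset (Fin n)).card = 3 := by
            rw [Finset.card_insert_of_notMem, Finset.card_insert_of_notMem, Finset.card_singleton]
            · simpa using fun h => hcon.2 h.symm
            · simp only [Finset.mem_insert, Finset.mem_singleton, not_or]
              exact ⟨fun h => hne h.symm, fun h => hcon.1 h.symm⟩
          have := Finset.card_le_card h3
          omega
      obtain ⟨q', hq', hcover⟩ := hrest
      rcases le_total
          ((prodBernoulli w).real {ω : BondConfig (Fin n) | (A.filter fun x => ω ∈ openConn q' x).card ≤ j})
          ((prodBernoulli w).real {ω : BondConfig (Fin n) | (A.filter fun x => ω ∈ openConn q x).card ≤ j}) with h | h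
      · exact ⟨q, hPA q hq, attached_le_of_twoGates_supp w A o q q' j (hgate q q' hcover) h⟩
      · exact ⟨q', hPA q' hq', attached_le_of_twoGates_supp w A o q' q j (hgate q' q fun r hr => (hcover r hr).symm) h⟩
  · exact cil_of_threePortRegion w A R o j ho hRA hclosed (le_antisymm hports hge)

end Summit.CriticalPhenomena.PercolationContinuityZ3.Theorems

end
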